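import Literature.MathematicalPhysics.QuantumFieldTheory.ConformalBootstrap3D.PointKernelK34L505Data
import Literature.MathematicalPhysics.QuantumFieldTheory.ConformalBootstrap3D.PointKernelK34L505Segs
import Literature.MathematicalPhysics.QuantumFieldTheory.ConformalBootstrap3D.PointKernelParts

/-!
# K34L505 certificate, kernel part file P5: one-cell head segments 53, 54 in level ranges

The head cells whose kernel evaluation exceeds one `decide` are one-cell segments of `hsegsK34L505`; each is
checked by `PCert.hPartSideOK` (side conditions) and `PCert.hPartOK` per level range `[n_lo, n_lo + count)`
against an integer claim, the claims summing to `≥ 0` (`PointKernel.partsOK`); soundness is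
`PCert.hParts_sound` (`PointKernelParts`).  The part files are mutually independent (each imports only
the data file); the ranges of one cell may span several of them, and the per-cell conclusions
`hparts_i` / `hcell_i` of those cells are assembled in `PointKernelK34L505.lean`.
Estimated kernel time 234 s.
-/

set_option maxRecDepth 100000
set_option maxHeartbeats 0

namespace Literature.MathematicalPhysics.QuantumFieldTheory.ConformalBootstrap3D.PointKernelK34L505

open Literature.MathematicalPhysics.QuantumFieldTheory.ConformalBootstrap3D.PointKernel

/-- levels `[74, 75)` of segment 53: partial lower sum `≥` claim. [folklore] -/
theorem part_53_10 : certK34L505.hPartOK (PCert.segAt hsegsK34L505 53) JHK34L505 74 1 (719526860137535682273980108329190) = true := by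
  decide +kernel

/-- one-cell segment 54 (row 4, cell `[40961/8192, 20481/4096]`, chord, `n_F = 66`,
7 level ranges): side conditions. [folklore] -/
theorem pside_54 : certK34L505.hPartSideOK (PCert.segAt hsegsK34L505 54) JHK34L505 = true := by
  decide +kernel

/-- its level ranges `(n_lo, count, claim)`. [folklore] -/
def partsK34L505_54 : List (ℕ × ℕ × ℤ) := [(0, 29, -2469845603648179011195878513319193200), (29, 12, 1812126871161342241261877588696019382), (41, 8, 419428073960329973704818555657507366), (49, 7, 153926490703024744600666660651060063), (56, 5, 53000534566037409417352421747095994), (61, 5, 28867254959443430769040298166535978), (66, 1, 2496378298001211442122988400974420)]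

/-- the ranges tile `[0, n_F]` and the claims sum to `≥ 0`. [folklore] -/
theorem pcov_54 : PointKernel.partsOK 66 partsK34L505_54 = true := by
  decide +kernel

/-- levels `[0, 29)` of segment 54: partial lower sum `≥` claim. [folklore] -/
theorem part_54_0 : certK34L505.hPartOK (PCert.segAt hsegsK34L505 54) JHK34L505 0 29 (-2469845603648179011195878513319193200) = true := by
  decide +kernel

/-- levels `[29, 41)` of segment 54: partial lower sum `≥` claim. [folklore] -/
theorem part_54_1 : certK34L505.hPartOK (PCert.segAt hsegsK34L505 54) JHK34L505 29 12 (1812126871161342241261877588696019382) = true := by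
  decide +kernel

/-- levels `[41, 49)` of segment 54: partial lower sum `≥` claim. [folklore] -/
theorem part_54_2 : certK34L505.hPartOK (PCert.segAt hsegsK34L505 54) JHK34L505 41 8 (419428073960329973704818555657507366) = true := by
  decide +kernel

end Literature.MathematicalPhysics.QuantumFieldTheory.ConformalBootstrap3D.PointKernelK34L505
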